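import Literature.NumberTheory.Automorphic.UnitaryGroupGenericity
import HarnessLib

/-!
# Erratum: the tree's `UnitaryGroup.unipotentRadical F E c N k` is, for `2k < N`, the CENTRE of the
# unipotent radical of the maximal parabolic `P_k` of `U(J_N)`, not the radical itself

Topic `NumberTheory/Automorphic`; namespace `Literature.NumberTheory.Automorphic.UnitaryGroup`.
THEOREMS ONLY (kernel-checked structure facts about an accepted definition); no definition, no
instance, no `sorry`.

The accepted `UnitaryGroup.unipotentRadical F E c N k` (`UnitaryGroupAutomorphicRep`) is
`U(J_N)(𝔸_F) ∩ (1 + 𝔫_k(𝔸_E))` with `𝔫_k = {X : X_{ij} ≠ 0 ⇒ i < k ≤ j}` — the ABELIAN unipotent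
radical of the `(k, N-k)` maximal parabolic of `GL_N` (`standardUnipotentRadical`, correct for the
cusp condition of `GL_N`). For the quasi-split unitary group of the anti-diagonal form `J_N` the
maximal parabolic `P_k` stabilising the isotropic flag `⟨e_1, …, e_k⟩` has block shape
`(k, N-2k, k)`; its unipotent radical `N_{P_k}` is two-step nilpotent for `2k < N`, and unitarity
PAIRS its `(k, N-2k)` block with its `(N-2k, k)` block (`apply_rev_rev_eq_neg_conjAdele`:
`u_{N-1-j, N-1-i} = -c(u_{ij})`). Since `𝔫_k` forces the `(N-2k, k)` block to vanish, the intersection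
`U(J_N) ∩ (1 + 𝔫_k)` kills the `(k, N-2k)` block too: what is left is the corner `(k, k)` block, the
CENTRE of `N_{P_k}`. Proved here:

* `apply_eq_zero_of_mem_unipotentRadical` (block shape), `apply_self_of_mem_unipotentRadical`,
  `unipotentRadical_le_adelicUnipotent` (`U ∩ (1 + 𝔫_k) ≤ N(𝔸_F)`, the upper unitriangular
  elements = the unipotent radical of the Borel subgroup, `adelicUnipotent`);
* **`apply_superdiag_eq_zero_of_mem_unipotentRadical`**: for `2k < N` EVERY super-diagonal entry
  `g_{i,i+1}` of `g ∈ unipotentRadical F E c N k` vanishes — in particular the simple-root coordinate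
  `g_{k-1,k}` of `N_{P_k}` (Rogawski (1990), §1.10: for `U(3)` the radical of `B` is
  `N = {u(x, z)}` with `x` arbitrary; here `x = 0`);
* `apply_superdiag_eq_zero_of_mem_unipotentRadical_three` (`N = 3`, `k = 1`: `g₀₁ = g₁₂ = 0`, i.e.
  `unipotentRadical F E c 3 1 = {u(0, z)} = Z(N)`);
* **`rootSum_eq_zero_of_mem_unipotentRadical`**, **`genericChar_eq_one_of_mem_unipotentRadical`**:
  for `2k < N` the sum of the free simple-root coordinates vanishes on `unipotentRadical k`, so for
  odd `N` EVERY Whittaker character `θ_{ψ,ψ₀}` (`genericChar`) is trivial on it.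

CONSEQUENCES (recorded, for consumers): the accepted `CuspCondition φ k`, `IsCuspForm`,
`cuspForms`, `CuspidalAutomorphicRepData` for `U_{E/F}(N)`, `N ≥ 3`, demand the vanishing of
`∫_{Z_k(F)\Z_k(𝔸_F)} φ(z g) dz` over the centre `Z_k` — for `U(3)` this annihilates every Whittaker
coefficient, so these «cusp forms» are the NON-GENERIC cusp forms only, a proper subclass of the
cusp forms of Rogawski (1990), §2.1 / Borel–Jacquet 4.4; likewise `constantTerm k`
(`UnitaryGroupConstantTerm`) is the constant term along `Z_k`, not along `N_{P_k}`. For `N = 2` and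
for `2k = N` (Siegel parabolic) the accepted objects are the printed ones. The genuine radical is
`U(J_N) ∩ unipotentRadicalGL (block labelling (k, N-2k, k))`; for the Borel subgroup it is
`adelicUnipotent` (letters `UnitaryGroupBorelHeight` / `UnitaryGroupBorelTruncation` use it).

## References

* J. D. Rogawski, *Automorphic Representations of Unitary Groups in Three Variables* (1990), §1.10
  (`B`, `N = {u(x, z)}`, `M` for `U(3)`), §2.1 (cusp forms) [Rogawski1990].
* C. P. Mok, *Endoscopic classification of representations of quasi-split unitary groups* (2015),
  §2.4 (standard parabolic subgroups of `U_{E/F}(N)`) [Mok2014].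
-/

noncomputable section

open Matrix NumberField IsDedekindDomain
open scoped MatrixGroups

namespace Literature.NumberTheory.Automorphic

namespace UnitaryGroup

variable {F E : Type} [Field F] [NumberField F] [Field E] [NumberField E] [Algebra F E]
  {c : E ≃ₐ[F] E} {N : ℕ}

/-- Entries of an element of `unipotentRadical F E c N k = U ∩ (1 + 𝔫_k)`: off the diagonal they
vanish outside the block `i < k ≤ j` (block shape of `𝔫_k`). [cite: Mok2014, §2.4] -/
theorem apply_eq_zero_of_mem_unipotentRadical {k : ℕ} {g : (quasiSplit F E c N).Adelic}
    (hg : g ∈ unipotentRadical F E c N k) {i j : Fin N} (hij : i ≠ j)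
    (h : ¬((i : ℕ) < k ∧ k ≤ (j : ℕ))) :
    (adelicVal F E c N _ g : Matrix (Fin N) (Fin N) (AdeleRing (𝓞 E) E)) i j = 0 := by
  obtain ⟨X, hX⟩ := hg
  have hmat : (adelicVal F E c N _ g : Matrix (Fin N) (Fin N) (AdeleRing (𝓞 E) E)) =
      1 + (X.toAdd : Matrix (Fin N) (Fin N) (AdeleRing (𝓞 E) E)) := by
    rw [← hX, coe_unipotentOfBlock]
  rw [hmat, Matrix.add_apply, Matrix.one_apply_ne hij, zero_add]
  exact apply_eq_zero_of_mem_blockNilpotent X.toAdd.2 h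

/-- Diagonal entries of an element of `unipotentRadical F E c N k` are `1`. [cite: Mok2014, §2.4] -/
theorem apply_self_of_mem_unipotentRadical {k : ℕ} {g : (quasiSplit F E c N).Adelic}
    (hg : g ∈ unipotentRadical F E c N k) (i : Fin N) :
    (adelicVal F E c N _ g : Matrix (Fin N) (Fin N) (AdeleRing (𝓞 E) E)) i i = 1 := by
  obtain ⟨X, hX⟩ := hg
  have hmat : (adelicVal F E c N _ g : Matrix (Fin N) (Fin N) (AdeleRing (𝓞 E) E)) =
      1 + (X.toAdd : Matrix (Fin N) (Fin N) (AdeleRing (𝓞 E) E)) := by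
    rw [← hX, coe_unipotentOfBlock]
  rw [hmat, Matrix.add_apply, Matrix.one_apply_eq,
    apply_eq_zero_of_mem_blockNilpotent X.toAdd.2 (fun hh => lt_irrefl _ (lt_of_lt_of_le hh.1 hh.2)),
    add_zero]

/-- **`U ∩ (1 + 𝔫_k) ≤ N(𝔸_F)`**: the accepted `unipotentRadical k` lies in the unipotent radical
`adelicUnipotent` of the Borel subgroup (upper unitriangular elements; Rogawski (1990), §1.10: `N`
the unipotent radical of the upper-triangular `B`). [cite: Rogawski1990, §1.10] -/
theorem unipotentRadical_le_adelicUnipotent (k : ℕ) :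
    unipotentRadical F E c N k ≤ adelicUnipotent F E c N := by
  intro g hg
  rw [mem_adelicUnipotent_iff, mem_upperUnitriangular_iff]
  refine ⟨fun i j hlt => ?_, fun i => apply_self_of_mem_unipotentRadical hg i⟩
  have hlt' : (j : ℕ) < (i : ℕ) := hlt
  exact apply_eq_zero_of_mem_unipotentRadical hg (fun hh => by rw [hh] at hlt'; exact lt_irrefl _ hlt')
    (fun hh => by omega)

/-- **For `2k < N` every super-diagonal entry of `g ∈ unipotentRadical F E c N k` vanishes.** The
only super-diagonal position inside the block `i < k ≤ j` is `(k-1, k)`; its partner under the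
unitarity pairing `g_{N-1-j,N-1-i} = -c(g_{ij})` (`apply_rev_rev_eq_neg_conjAdele`) sits in row
`N-1-k ≥ k`, outside the block, hence is `0`, hence so is `g_{k-1,k}`. So the simple-root coordinate
of the genuine radical `N_{P_k}` (Rogawski (1990), §1.10: `u(x, z)` with `x` free) is absent.
[cite: Rogawski1990, §1.10] -/
theorem apply_superdiag_eq_zero_of_mem_unipotentRadical {k : ℕ} (h2k : 2 * k < N)
    {g : (quasiSplit F E c N).Adelic} (hg : g ∈ unipotentRadical F E c N k) {i j : Fin N}
    (hij : (i : ℕ) + 1 = j) :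
    (adelicVal F E c N _ g : Matrix (Fin N) (Fin N) (AdeleRing (𝓞 E) E)) i j = 0 := by
  have hne : i ≠ j := fun h => by rw [h] at hij; omega
  by_cases hblock : (i : ℕ) < k ∧ k ≤ (j : ℕ)
  · -- the position `(k-1, k)`: use the unitarity pairing with `(N-1-k, N-k)`, which is outside the block
    have hu : g ∈ adelicUnipotent F E c N := unipotentRadical_le_adelicUnipotent k hg
    have key := apply_rev_rev_eq_neg_conjAdele (⟨g, hu⟩ : adelicUnipotent F E c N) hij
    change (adelicVal F E c N _ g : Matrix (Fin N) (Fin N) (AdeleRing (𝓞 E) E)) j.rev i.rev =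
      -conjAdele F E c ((adelicVal F E c N _ g : Matrix (Fin N) (Fin N) (AdeleRing (𝓞 E) E)) i j) at key
    have hpartner : (adelicVal F E c N _ g : Matrix (Fin N) (Fin N) (AdeleRing (𝓞 E) E)) j.rev i.rev = 0 := by
      refine apply_eq_zero_of_mem_unipotentRadical hg (fun h => hne (Fin.rev_injective h).symm) ?_
      rintro ⟨h1, -⟩
      rw [Fin.val_rev] at h1
      omega
    rw [hpartner, eq_comm, neg_eq_zero, conjAdele_apply] at key
    exact (smul_eq_zero_iff_eq c).1 key
  · exact apply_eq_zero_of_mem_unipotentRadical hg hne hblock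

/-- **`N = 3`, `k = 1`: `g₀₁ = 0` and `g₁₂ = 0`** for `g ∈ unipotentRadical F E c 3 1`, i.e.
`g = u(0, z)`: the accepted `unipotentRadical F E c 3 1` is the centre `Z(N) = {u(0, z)}` of the
Heisenberg group `N = {u(x, z)}` of Rogawski (1990), §1.10, not `N`. [cite: Rogawski1990, §1.10] -/
theorem apply_superdiag_eq_zero_of_mem_unipotentRadical_three {g : (quasiSplit F E c 3).Adelic}
    (hg : g ∈ unipotentRadical F E c 3 1) :
    (adelicVal F E c 3 _ g : Matrix (Fin 3) (Fin 3) (AdeleRing (𝓞 E) E)) 0 1 = 0 ∧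
      (adelicVal F E c 3 _ g : Matrix (Fin 3) (Fin 3) (AdeleRing (𝓞 E) E)) 1 2 = 0 :=
  ⟨apply_superdiag_eq_zero_of_mem_unipotentRadical (by norm_num) hg rfl,
    apply_superdiag_eq_zero_of_mem_unipotentRadical (by norm_num) hg rfl⟩

/-- **The free simple-root coordinates vanish on `unipotentRadical k` (`2k < N`)**:
`rootSum u = Σ_{2i+2<N} u_{i,i+1} = 0`. [cite: Rogawski1990, §1.10] -/
theorem rootSum_eq_zero_of_mem_unipotentRadical {k : ℕ} (h2k : 2 * k < N) {u : adelicUnipotent F E c N}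
    (hu : (u : (quasiSplit F E c N).Adelic) ∈ unipotentRadical F E c N k) : rootSum u = 0 := by
  rw [rootSum_def]
  refine Finset.sum_eq_zero fun i _ => Finset.sum_eq_zero fun j _ => ?_
  split_ifs with h
  · exact apply_superdiag_eq_zero_of_mem_unipotentRadical h2k hu h.1
  · rfl

/-- **Every Whittaker character is trivial on `unipotentRadical k`** (`N` odd, `2k < N`):
`θ_{ψ,ψ₀}(u) = ψ(rootSum u) = ψ(0) = 1`. Hence a `φ` satisfying the accepted `CuspCondition φ k` on
`U(2m+1)` has `θ`-Whittaker coefficients that factor through `∫_{Z_k(F)\Z_k(𝔸_F)} φ(z g) dz = 0`: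
the accepted cusp forms on `U(3)` are non-generic (Rogawski (1990), §2.1 for the printed notion).
[cite: Rogawski1990, §2.1] -/
theorem genericChar_eq_one_of_mem_unipotentRadical (hN : Odd N) {k : ℕ} (h2k : 2 * k < N)
    (ψ ψ₀ : AddChar (AdeleRing (𝓞 E) E) Circle) {u : adelicUnipotent F E c N}
    (hu : (u : (quasiSplit F E c N).Adelic) ∈ unipotentRadical F E c N k) : genericChar ψ ψ₀ u = 1 := by
  rw [genericChar_eq_of_odd hN, rootSum_eq_zero_of_mem_unipotentRadical h2k hu, AddChar.map_zero_eq_one,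
    Circle.coe_one]

end UnitaryGroup

end Literature.NumberTheory.Automorphic
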